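import Summits.BirchSwinnertonDyer.Rank1Residual.X11b.Three.BDPExistsGlue
import Summits.BirchSwinnertonDyer.Rank1Residual.X11b.Three.HsiehDisplayGlue
import Summits.BirchSwinnertonDyer.Rank1Residual.X11b.Three.CharTorsionOnA1
import Summits.BirchSwinnertonDyer.Rank1Residual.X11b.ChaRoute
import HarnessLib

/-!
# X11b @ `p = 3`, S18(b): H1 = `Three.BDPExistsAt₃ W` FROM PRINT — Hsieh 2014 Thm. 1 (typed in
# Hsieh's frame, `Literature/…/AnticyclotomicRankinSelbergPAdicLFunction.lean`) + ONE named residual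
# `Three.HsiehFrameResidualAt₃ W` = (λ) + (t1)–(t3) "an `R₀`-rational re-normalisation of a Hsieh
# witness exists" ⟹ `BDPExistsAt₃ W`

HONEST FRAMING (cell `b2b-bsdres`, run/shared/lean/b2b/bsd-rank1-residual/, verbatim in every
file): the goal of the cell is to DELETE the COMBINATION-SHAPED residual classes of the
Birch–Swinnerton-Dyer formula for ALL analytic-rank `≤ 1` elliptic curves over `ℚ` — assembled
STRICTLY from published theorems — so that the rank-`≤ 1` remainder becomes exactly the
CONSTRUCTION-SHAPED classes, which are TYPED, NOT attempted. This is not "finishing BSD". Team N8/O2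
(X11b at `3`: `3 ‖ N`, `r_an = 1`, `E[3]` irreducible): research route; nothing booked; NO label
changes; O2 stays OPEN. THEOREMS + ONE `@[conjecture]`-tagged named residual (an obligation node
stated in our theories — NOT a vendored fact, NOT asserted); no `sorry`.

PROVENANCE: sub-target S18 (OWNERS R7-22, R7-27, R7-29, R7-36, R7-37; lead x11b3 GEN 6), seat
`b2b-bsdres-x11b3-p7` (gen. 3) = S18(b) Lean hand; lit1 = fact pen + proposer of S18(a) (LIT-TABLE
L54, L56, L57); r2 = dictionary (`D3-DICTIONARY.md`, `gen6/D3EPS.md`: (+ε) OUTCOME A, (t3) carried by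
print, (t1) RING the residual); r1 = second reader (S-a…S-f, `S18-SECOND-READER-PREP.md`); p6 = glue
S22 (`BDPExistsGlue.lean`, assembly `bdpExistsAt₃_of_forall_exists_isBDPLFunction`, p256792).

## What this file does (R7-27 (b): "h1 SHRINKS from 'the BDP `L`-function exists at `3 ‖ N`' to
## 'Hsieh's printed element lands in the tree's frame' — an honest, smaller, named binder")

H1 = `Three.BDPExistsAt₃ W` asks, over S0's datum `(N, K, Dt, H, ι, P, κ, γ, 𝔭, f)`, for a datum
`ι' : ℚ̄₃ ≃ ℂ` inducing `𝔭` and a frame `(Ω_K ≠ 0, Ω_p ∈ R₀ˣ, L ∈ R₀⟦T⟧)` with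
`IsBDPLFunction ι' 𝔭 κ γ f Ω_K Ω_p L` (Castella 2018, Thm. 3.1 display; at `p ∣ N` printed for `p ≥ 5`
by reference). The ONLY printed construction at `3 ‖ N` is Hsieh 2014, Thm. 1 (`𝔑` = prime-to-`p`
conductor; (ord) = `p` split — lit1 L54/L56), typed as the Literature fact
`hsieh2014_exists_anticyclotomicPAdicLFunction` IN HSIEH'S FRAME with CM type `{σ̄₀}` and in the
twisted variable (so that its display sits at `𝔭` and at tree infinity type `(n, −n)` like
`IsBDPLFunction`, differing from `bdpInterpolationValue` EXACTLY by the real monomial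
`(3/(16 (Im δ)²))^{n}`, `hsiehInterpolationValue_eq_mul_bdpInterpolationValue`), its element
`Q ∈ 𝒪_{ℂ_3}⟦T⟧` and period `Ω_p ∈ 𝒪_{ℂ_3}^×` (`IsHsiehLFunction`). What separates this from the tree
frame is EXACTLY:

* **`HsiehFrameResidualAt₃ W`** (`@[conjecture]`, hypothesis-shaped; the ONE named residual): over
  the data of S22's assembly at `p = 3` (`ι', K, 𝔭, κ, γ, N, f` with S0's clauses), (λ) there is an
  auxiliary Hecke character `λ` of `K` — unitary, tree infinity type `(1, −1)`, trivial on `𝔸_ℚ^×`,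
  unramified outside `3` — WITH a `3`-adic avatar `r_λ` factoring through the anticyclotomic
  `ℤ₃`-extension (Castella 2018, p. 9 l. 42: "Let `ψ` be an anticyclotomic Hecke character of `K` of
  infinity type `(1,−1)`"; that `ψ̂` may be taken through `Γ⁻` after a finite-order twist of
  `3`-power conductor is folklore, NOT typed in the tree — conjunct (λ); the tree PROVES the unramified
  version `TorusCharacters.exists_unramified_heckeCharacter_rat` (type `(2e,0)` unitary-arch, trivial on
  `𝕀_ℚ`), but an unramified `λ̂` need not factor through `Γ⁻`), AND (t1)–(t3) for EVERY
  Hsieh witness `(A, Ω_K, C, Ω_p, Q)` for this `λ` (the conclusion of the fact, verbatim) there is an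
  `R₀`-FRAME `(Ω_K' ≠ 0, Ω_p' ∈ R₀ˣ, L ∈ R₀⟦T⟧)` realising HSIEH's display `ι'⁻¹(hsiehInterpolationValue
  3 f 𝔭 χ n A Ω_K' 1)·Ω_p'^{4n}` on the same range — "Hsieh's element is `R₀ = 𝒪(ℚ̂₃^ur)`-rational up to
  the admissible re-normalisation of its periods and unit constant": Hsieh prints `Λ = Z̄₃⟦Γ⁻⟧`, `Ω_p ∈ Z̄₃^×`
  [arXiv:1112.1580 p. 3 l. 28, p. 7 l. 36, p. 23 ll. 63–66], his proof runs over `𝓦 = W(𝔽̄_p)[λ]`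
  [p. 21 l. 30, p. 25 l. 7] with `λ` ramified at `3` and Gauss sums in `C(π, λ)`; `R₀`-coefficients
  are printed only by Castella–Hsieh 2018, Def. 3.5 (`p ∤ N`) [arXiv:1505.08165 p. 10 l. 85–p. 11
  l. 3] and Castella 2018, Thm. 3.1 (`p ≥ 5`) [arXiv:1704.06608 p. 9 ll. 17–25, 52–57] (lit1 L56
  (t1)/(t2); r2 D3EPS §0). WHY (t1)/(t2) are not predicated of the witness `Q, Ω_p` themselves: the
  fact's `∃` admits the re-normalisations `Ω_p ↦ Ω_p·u^{a/4}`, `Q ↦ c·(1+T)^{a}·Q` (`u = r_χ₀(γ) ∈ ℚ̄₃`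
  possibly RAMIFIED, `a ∈ ℤ₃`), under which "`Ω_p ∈ R₀`" is not invariant; and WHY (t2) is not
  absorbed into `Ω_K` (r2's "`Ω_p := 1`"): `Ω_p ∈ 𝒪_{ℂ_3}` need not lie in `ℚ̄₃`, the range of `ι'⁻¹`.
  The residual CONSUMES the fact: its inner `∀` needs an actual Hsieh witness, which only the fact
  provides. NOTHING of it is asserted; `h1` of HALVES shrinks to (fact) + (this).

* **`bdpExistsAt₃_of_hsieh2014 : hsieh2014_exists_anticyclotomicPAdicLFunction →
  HsiehFrameResidualAt₃ W → BDPExistsAt₃ W`** — S22's assembly fed, datum by datum: the residual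
  supplies `(λ, r_λ)`; the fact at `p = 3` (`3 ≠ 2`; `IsNewformOf W f ⇒ IsNewform0 f`; `3 ‖ N_E`
  from `ClassX11b W 3` via `not_sq_dvd_conductorNorm_of_mult`; `3` split, `3 ∈ 𝔭`, `ι'` induces `𝔭`,
  every `ℓ ∣ N` splits, `κ` anticyclotomic with generator `γ` — all verbatim from the datum) supplies
  `(A, Ω_K, C, Ω_p, Q)`; the residual turns it into an `R₀`-frame with Hsieh's display (`C = 1`); and the
  GLUE of `X11b/Three/HsiehDisplayGlue.lean` — (g1) `Ω_K₁ := Ω_K'·(16 A²/3)^{1/4}` makes the display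
  LITERALLY `bdpInterpolationValue 3 f 𝔭 χ n Ω_K₁` (`exists_isBDPLFunction_of_hsiehDisplay`); its
  converse `hsiehDisplay_of_isBDPLFunction` and the pinned form `hsiehDisplayFrame_of_coeff_mem`
  CALIBRATE the residual: its rationality clause asks for nothing more than a tree frame with
  `Ω_p ∈ R₀ˣ`, `L ∈ R₀⟦T⟧` — the `R₀`-descent, not a new interpolation property — and follows from
  "(t1) coefficients of `Q` in `R₀`, (t2) `Ω_p ∈ R₀ˣ`, (t3) `ι'⁻¹C ∈ R₀ˣ`" whenever those hold of the
  witness. No `(1+T)^{a}` (S23) and no twist is needed: they were absorbed in the typing of the fact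
  (its (W2)/(W3)).
* `stepLAt_of_halves₃_onA1_of_hsieh2014`, `bsdp_of_halves₃_onA1_of_hsieh2014`,
  `missingInputAt_of_halves₃_onA1_of_hsieh2014`: p2's A1 corollaries (`CharTorsionOnA1.lean`) with
  `h1` REPLACED by (fact, residual); `h2 = BDPValueAt₃`, `h3 = IMCDivAt₃` kept.

KILL/HONESTY CLAUSE (R7-22/R7-36): this file imports lit1's Literature fact and is proposed only
after that fact is ACCEPTED (gates G1–G3); until then `h1` stays the HALVES binder. No mark moves.

## References

* [Hsieh2014] M.-L. Hsieh, Doc. Math. 19 (2014), Thm. 1 (arXiv:1112.1580 pp. 3–4), pp. 7, 21, 23, 25.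
* [CastellaHsieh2018] F. Castella, M.-L. Hsieh, Math. Ann. 370 (2018), Def. 3.5, Prop. 3.6
  (arXiv:1505.08165 pp. 10–11).
* [Castella2018] F. Castella, Camb. J. Math. 6 (2018), Thm. 3.1, p. 9 (arXiv:1704.06608).
* Cell files: `cells/x11b3/OWNERS.md` R7-22/27/29/36/37; `LIT-TABLE.md` L54, L56, L57; r2
  `gen6/D3EPS.md`; r1 `D3-INPUT-r1.md` v2, `S18-SECOND-READER-PREP.md`.
-/

noncomputable section

open scoped Classical

open WeierstrassCurve NumberField IsDedekindDomain Field
  Literature.NumberTheory.EllipticCurves Literature.NumberTheory.EllipticCurves.GreenbergSelmer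
  Literature.NumberTheory.EllipticCurves.ModularForms Literature.NumberTheory.EllipticCurves.Rank1Residual
  Literature.NumberTheory.EllipticCurves.Rank1Residual.Typed Literature.NumberTheory.EllipticCurves.Wuthrich2014
  Literature.NumberTheory.GaloisRepresentations Literature.NumberTheory.GaloisCohomology
  Literature.NumberTheory.Automorphic
  Summit.BirchSwinnertonDyer.Rank1Residual.X11b.AcSelmer Summit.BirchSwinnertonDyer.Rank1Residual.X11b.LocBridge

namespace Summit.BirchSwinnertonDyer.Rank1Residual.X11b.Three


/-! ### The named residual: `R₀`-rationality of (a re-normalisation of) Hsieh's witness -/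

section Residual

variable (W : WeierstrassCurve ℚ) [W.IsElliptic] [W.IsGloballyMinimal]

/-- **`HsiehFrameResidualAt₃ W` — "Hsieh's printed element lands in the tree's frame"** (R7-27 (b),
R7-37 (t1) RING (+ (t2)); hypothesis-shaped; the ONE named residual of S18). Over the data of S22's
assembly at `p = 3` — `ι' : ℚ̄₃ ≃ ℂ`, S0's `K, 𝔭, κ, γ`, the newform `f ∈ S_2(Γ₀(N))` of `E` with
`N = N_E`, `ClassX11b W 3`, `Surj W 3`, `K` imaginary quadratic with `d_K` odd and the classical Heegner
hypothesis for `N`, `3` split, `3 ∈ 𝔭` with `e = f = 1`, `ι'` inducing `𝔭`, the (Heeg) clause, `κ`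
anticyclotomic with generator `γ`: (λ) there is an auxiliary Hecke character `λ` of `K` (unitary, tree
infinity type `(1, −1)`, trivial on `𝔸_ℚ^×`, unramified outside `3`) with a `3`-adic avatar `r_λ`
(`IsPAdicAvatarOf ι' λ r_λ`) factoring through the anticyclotomic `ℤ₃`-extension (`FactorsThroughZp κ
r_λ`) — Castella's `ψ` [arXiv:1704.06608 p. 9 l. 42] taken through `Γ⁻` (folklore, not typed) —, AND
(t1)+(t2)+(t3) for every Hsieh witness `(A, Ω_K, C, Ω_p, Q)` for `λ` (`0 < A`, `Ω_K ≠ 0`,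
`‖ι'⁻¹C‖ = 1`, `‖Ω_p‖ = 1`, `IsHsiehLFunction ι' 𝔭 κ γ f A Ω_K C Ω_p Q` — the conclusion of
`hsieh2014_exists_anticyclotomicPAdicLFunction` verbatim) there is an `R₀`-frame `Ω_K' ≠ 0`,
`Ω_p' ∈ R₀ˣ`, `L ∈ R₀⟦T⟧` taking at every unramified `χ` of tree type `(n, −n)`, `n > 0`, with avatar
`r` through `κ`, the value `ι'⁻¹(hsiehInterpolationValue 3 f 𝔭 χ n A Ω_K' 1) · Ω_p'^{4n}` (constant
`C = 1`: the unit absorbed, r2's (t3) "subsumed by (t1) for the final element") at `T = r(γ) − 1` —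
i.e. "Hsieh's element `Q ∈ Z̄₃⟦Γ⁻⟧` [arXiv:1112.1580 p. 3 l. 28, p. 7 l. 36], period `Ω_p ∈ Z̄₃^×`
[p. 23 ll. 63–66] and unit `C(π,λ) ∈ Z̄_{(3)}^×` [p. 4 l. 18] are, up to the admissible
re-normalisation `(Ω_K, Ω_p, Q) ↦ (Ω_K', Ω_p', C⁻¹·Q·…)`, `R₀ = 𝒪(ℚ̂₃^ur)`-rational" (printed only by
Castella–Hsieh 2018 Def. 3.5 under `p ∤ N` and Castella 2018 Thm. 3.1 for `p ≥ 5`; Hsieh's proof runs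
over `𝓦 = W(𝔽̄_p)[λ]` [p. 21 l. 30, p. 25 l. 7]). The element `L` is pinned by its values (the
interpolation points `r(γ) − 1` accumulate at `T = 0`; identity theorem), so H2/H3 speak about the
same object up to `R₀⟦T⟧ˣ`. TYPED, not attempted; nothing asserted.
[cite: Hsieh2014, Thm. 1 (arXiv:1112.1580 pp. 3–4) (frame of the antecedent; the R₀-descent at 3 ∣ N is NOT in print)]
[cite: CastellaHsieh2018, Def. 3.5 and Prop. 3.6 (arXiv:1505.08165 pp. 10–11) (shape of the consequent, printed for p ∤ N)] -/
@[conjecture]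
def HsiehFrameResidualAt₃ : Prop :=
  ∀ (ι' : PadicAlgCl 3 ≃+* ℂ) (K : Type) [Field K] [NumberField K]
    (𝔭 : HeightOneSpectrum (𝓞 K)) (κ : ZpExtension K 3) (γ : Field.absoluteGaloisGroup K)
    {N : ℕ} [NeZero N] {f : CuspForm (CongruenceSubgroup.Gamma0 N) 2}, IsNewformOf W f →
    ClassX11b W 3 → Surj W 3 → W.conductorNorm ℤ = N → IsImaginaryQuadratic K →
    Odd (NumberField.discr K) → SatisfiesHeegnerHypothesis N K →
    ((Ideal.span {(3 : ℤ)}).primesOver (𝓞 K)).ncard = 2 → ((3 : ℕ) : 𝓞 K) ∈ 𝔭.asIdeal →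
    𝔭.asIdeal.ramificationIdx (𝓞 ℚ) = 1 → 𝔭.asIdeal.inertiaDeg (𝓞 ℚ) = 1 →
    (∀ (w : InfinitePlace K) (k : 𝓞 K), k ∈ 𝔭.asIdeal ↔ ‖ι'.symm (w.embedding (k : K))‖ < 1) →
    (∀ ℓ : ℕ, ℓ.Prime → ℓ ∣ N → ∃ v : HeightOneSpectrum (𝓞 K), Ideal.absNorm v.asIdeal = ℓ) →
    κ.IsAnticyclotomic → κ.IsTopGenerator γ →
    ∃ (lam : HeckeCharacter K) (rlam : FramedGaloisRep K (PadicAlgCl 3) 1),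
      lam.IsUnitary ∧ lam.HasInfinityType (fun _ ↦ (1 : ℤ)) (fun _ ↦ (-1 : ℤ)) ∧
      (∀ x : ideleGroup ℚ, lam (AdeleRing.ideleBaseChange ℚ K x) = 1) ∧
      (∀ v : HeightOneSpectrum (𝓞 K), ((3 : ℕ) : 𝓞 K) ∉ v.asIdeal → lam.IsUnramifiedAt v) ∧
      IsPAdicAvatarOf ι' lam rlam ∧ FactorsThroughZp κ rlam ∧
      ∀ (A : ℝ) (ΩK C : ℂ) (Ωp : ℂ_[3]) (Q : PowerSeries (PadicComplexInt 3)),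
        0 < A → ΩK ≠ 0 → ‖((ι'.symm C : PadicAlgCl 3) : ℂ_[3])‖ = 1 → ‖Ωp‖ = 1 →
        IsHsiehLFunction ι' 𝔭 κ γ f A ΩK C Ωp Q →
        ∃ (ΩK' : ℂ) (Ωp' : (unrIntegers 3)ˣ) (L : UnrSeries 3), ΩK' ≠ 0 ∧
          ∀ (χ : HeckeCharacter K) (n : ℕ), 0 < n →
            (∀ v : HeightOneSpectrum (𝓞 K), χ.IsUnramifiedAt v) →
            χ.HasInfinityType (fun _ ↦ (n : ℤ)) (fun _ ↦ -(n : ℤ)) →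
            ∀ r : FramedGaloisRep K (PadicAlgCl 3) 1, IsPAdicAvatarOf ι' χ r → FactorsThroughZp κ r →
              L.HasValueAt (avatarValueAt r γ - 1)
                (((ι'.symm (hsiehInterpolationValue 3 f 𝔭 χ n A ΩK' 1) : PadicAlgCl 3) : ℂ_[3]) *
                  ((Ωp' : unrIntegers 3) : ℂ_[3]) ^ (4 * n))

end Residual

/-! ### S18(b): the fact and the residual discharge H1 -/

section Assembly

variable (W : WeierstrassCurve ℚ) [W.IsElliptic] [W.IsGloballyMinimal]

/-- **S18(b): `hsieh2014_exists_anticyclotomicPAdicLFunction ∧ HsiehFrameResidualAt₃ W ⟹ BDPExistsAt₃ W`.**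
S22's assembly `bdpExistsAt₃_of_forall_exists_isBDPLFunction` is fed, for every datum, with: the
residual's `(λ, r_λ)`; Hsieh's theorem at `p = 3` (`3 ≠ 2`; `IsNewformOf W f ⇒ IsNewform0 f`; `3 ‖ N_E`
from `ClassX11b W 3` (`Mult W 3`, `not_sq_dvd_conductorNorm_of_mult`); `K` imaginary quadratic, `3`
split, `3 ∈ 𝔭`, `ι'` induces `𝔭`, every `ℓ ∣ N` splits, `κ` anticyclotomic with generator `γ` —
verbatim from the datum) giving `(A, Ω_K, C, Ω_p, Q)`; the residual's `R₀`-frame `(Ω_K', Ω_p', L)`;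
and the glue `exists_isBDPLFunction_of_hsiehDisplay` (`Ω_K₁ = (16A²/3)^{1/4}Ω_K'`). CONDITIONAL on the
named fact `hH` (Hsieh 2014 Thm. 1, published) and the named residual `hres` (NOT in print at
`3 ∣ N`); nothing booked; O2 OPEN. [cite: Hsieh2014, Thm. 1 (arXiv:1112.1580 pp. 3–4)] -/
theorem bdpExistsAt₃_of_hsieh2014 (hH : hsieh2014_exists_anticyclotomicPAdicLFunction)
    (hres : HsiehFrameResidualAt₃ W) : BDPExistsAt₃ W := by
  haveI : Fact (Nat.Prime 3) := ⟨Nat.prime_three⟩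
  refine bdpExistsAt₃_of_forall_exists_isBDPLFunction W ?_
  intro ι' K _ _ 𝔭 κ γ N _ f hnf hX hsurj hN hK hodd hHeeg h3 h𝔭 he hf hι' hHeegC hκ hγ
  obtain ⟨lam, rlam, hunit, hinfl, hAQ, hunrl, havl, hfacl, hR⟩ :=
    hres ι' K 𝔭 κ γ hnf hX hsurj hN hK hodd hHeeg h3 h𝔭 he hf hι' hHeegC hκ hγ
  have h9 : ¬ 3 ^ 2 ∣ N := hN ▸ not_sq_dvd_conductorNorm_of_mult W 3 hX.2.2.1
  have h3N : 3 ∣ N := hN ▸ dvd_conductorNorm_of_mult hX.2.2.1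
  obtain ⟨A, ΩK, C, Ωp, Q, hA, hΩK, hC, hΩp, hQ⟩ := hH ι' K 𝔭 κ γ f lam rlam (by norm_num) hnf.1 h9
    hK h3 h𝔭 hι' hHeeg hunit hinfl hAQ hunrl havl hfacl hκ hγ
  obtain ⟨ΩK', Ωp', L, hΩK', hL⟩ := hR A ΩK C Ωp Q hA hΩK hC hΩp hQ
  obtain ⟨ΩK₁, hΩK₁, hBDP⟩ :=
    exists_isBDPLFunction_of_hsiehDisplay ι' 𝔭 κ γ f h3N hA hΩK' ((Ωp' : unrIntegers 3) : ℂ_[3]) L hL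
  exact ⟨ΩK₁, Ωp', L, hΩK₁, hBDP⟩

/-- **`Three.StepLAt W` on A1 from print + residual**: p2's `stepLAt_of_halves₃_onA1` with `h1`
replaced by (Hsieh 2014 Thm. 1, `HsiehFrameResidualAt₃ W`); `h2 = BDPValueAt₃`, `h3 = IMCDivAt₃`
kept; CTL₀ is a theorem on A1 (X11b@3 ∧ (ram) ∧ `3 ∤ ∏ c_ℓ`). CONDITIONAL on every listed binder;
nothing booked. [cite: Hsieh2014, Thm. 1 (arXiv:1112.1580 pp. 3–4)] [cite: Castella2018, Thm. 2.3 (p. 5), §5 (p. 12)] -/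
theorem stepLAt_of_halves₃_onA1_of_hsieh2014
    (hKo : ∀ (N : ℕ) [NeZero N] (W : WeierstrassCurve ℚ) (K : Type) [Field K] [NumberField K],
      kolyvagin N W K)
    (hPT : ∀ (K : Type) [Field K] [NumberField K], poitouTate_selmerStructure_duality K)
    (hPT2 : ∀ (K : Type) [Field K] [NumberField K], poitouTate_sha_tateDual K)
    (hEP : ∀ (K : Type) [Field K] [NumberField K] (v : HeightOneSpectrum (𝓞 K)),
      localEulerPoincareCharacteristic (v.adicCompletion K))
    (hcd : fieldCdLE_two_of_numberField)
    (hnf : exists_isNewformOf) (hH : hsieh2014_exists_anticyclotomicPAdicLFunction)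
    (hX : ClassX11b W 3) (hram : Ram W 3) (htam : ¬ 3 ∣ W.tamagawaProduct)
    (hres : HsiehFrameResidualAt₃ W) (h2 : BDPValueAt₃ W) (h3 : IMCDivAt₃ W) : StepLAt W :=
  stepLAt_of_halves₃_onA1 hKo hPT hPT2 hEP hcd hnf hX hram htam (bdpExistsAt₃_of_hsieh2014 W hH hres)
    h2 h3

/-- **`H2 ∧ H3 ⟹ BSD(E,3)` on A1 given Hsieh 2014 Thm. 1 and the frame residual**: p2's
`bsdp_of_halves₃_onA1` with `h1` DROPPED in favour of (fact, residual). CONDITIONAL on every listed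
fact binder, the named residual and the two typed halves; per pair; nothing booked; no label change;
O2 OPEN. [cite: Hsieh2014, Thm. 1 (arXiv:1112.1580 pp. 3–4)] [cite: Castella2018, Thm. 2.3 (p. 5), Thm. 3.2 (p. 9), §5 (p. 12)]
[cite: JetchevSkinnerWan2017, Thm. 3.3.1 (p. 11)] [cite: Miller2011LMS, Def. 1.1] -/
theorem bsdp_of_halves₃_onA1_of_hsieh2014
    (hGZ : ∀ (N : ℕ) [NeZero N] (W : WeierstrassCurve ℚ) (K : Type) [Field K] [NumberField K],
      gross_zagier N W K)
    (hKo : ∀ (N : ℕ) [NeZero N] (W : WeierstrassCurve ℚ) (K : Type) [Field K] [NumberField K],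
      kolyvagin N W K)
    (hB : ∀ (N : ℕ) [NeZero N] (W : WeierstrassCurve ℚ) (K : Type) [Field K] [NumberField K],
      Kolyvagin1990_padicValNat_card_sha_le N W K)
    (hSk : Skinner2016.thmC_padicValRat_bsd_rank_zero) (hWu : sha_dvd_analyticSha)
    (hGZK : rank_eq_analyticRank_of_analyticRank_le_one) (hmod : hasEntireLFunction_rat)
    (hnf : exists_isNewformOf) (hHL : HoffsteinLuo1997_exists_twist_L_one_ne_zero)
    (hMaz : mazur_not_dvd_maninConstant_of_odd)
    (hPT : ∀ (K : Type) [Field K] [NumberField K], poitouTate_sum_localTatePairing_eq_zero K)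
    (hEP : ∀ (K : Type) [Field K] [NumberField K] (v : HeightOneSpectrum (𝓞 K)),
      localEulerPoincareCharacteristic (v.adicCompletion K))
    (hPTs : ∀ (K : Type) [Field K] [NumberField K], poitouTate_selmerStructure_duality K)
    (hPT2 : ∀ (K : Type) [Field K] [NumberField K], poitouTate_sha_tateDual K)
    (hcd : fieldCdLE_two_of_numberField) (hH : hsieh2014_exists_anticyclotomicPAdicLFunction)
    (hX : ClassX11b W 3) (hram : Ram W 3) (htam : ¬ 3 ∣ W.tamagawaProduct)
    (hres : HsiehFrameResidualAt₃ W) (h2 : BDPValueAt₃ W) (h3 : IMCDivAt₃ W) : BSDp W 3 :=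
  bsdp_of_halves₃_onA1 hGZ hKo hB hSk hWu hGZK hmod hnf hHL hMaz hPT hEP hPTs hPT2 hcd hX hram htam
    (bdpExistsAt₃_of_hsieh2014 W hH hres) h2 h3

/-- **Per-pair bookkeeping**: on A1, under Hsieh 2014 Thm. 1, the frame residual, H2, H3 and the
listed facts, the CLASS's typed missing input `X11Three.MissingInputAt W` holds at the pair `(E, 3)`
(p2's `missingInputAt_of_halves₃_onA1` with `h1` replaced). The `Prop` about the CLASS is NOT made
available; nothing booked. [cite: Miller2011LMS, §1 and Def. 1.1 (arXiv:1010.2431 p. 3)] -/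
theorem missingInputAt_of_halves₃_onA1_of_hsieh2014
    (hGZ : ∀ (N : ℕ) [NeZero N] (W : WeierstrassCurve ℚ) (K : Type) [Field K] [NumberField K],
      gross_zagier N W K)
    (hKo : ∀ (N : ℕ) [NeZero N] (W : WeierstrassCurve ℚ) (K : Type) [Field K] [NumberField K],
      kolyvagin N W K)
    (hB : ∀ (N : ℕ) [NeZero N] (W : WeierstrassCurve ℚ) (K : Type) [Field K] [NumberField K],
      Kolyvagin1990_padicValNat_card_sha_le N W K)
    (hSk : Skinner2016.thmC_padicValRat_bsd_rank_zero) (hWu : sha_dvd_analyticSha)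
    (hGZK : rank_eq_analyticRank_of_analyticRank_le_one) (hmod : hasEntireLFunction_rat)
    (hnf : exists_isNewformOf) (hHL : HoffsteinLuo1997_exists_twist_L_one_ne_zero)
    (hMaz : mazur_not_dvd_maninConstant_of_odd)
    (hPT : ∀ (K : Type) [Field K] [NumberField K], poitouTate_sum_localTatePairing_eq_zero K)
    (hEP : ∀ (K : Type) [Field K] [NumberField K] (v : HeightOneSpectrum (𝓞 K)),
      localEulerPoincareCharacteristic (v.adicCompletion K))
    (hPTs : ∀ (K : Type) [Field K] [NumberField K], poitouTate_selmerStructure_duality K)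
    (hPT2 : ∀ (K : Type) [Field K] [NumberField K], poitouTate_sha_tateDual K)
    (hcd : fieldCdLE_two_of_numberField) (hH : hsieh2014_exists_anticyclotomicPAdicLFunction)
    (hX : ClassX11b W 3) (hram : Ram W 3) (htam : ¬ 3 ∣ W.tamagawaProduct)
    (hres : HsiehFrameResidualAt₃ W) (h2 : BDPValueAt₃ W) (h3 : IMCDivAt₃ W) :
    X11Three.MissingInputAt W :=
  missingInputAt_of_halves₃_onA1 hGZ hKo hB hSk hWu hGZK hmod hnf hHL hMaz hPT hEP hPTs hPT2 hcd hX hram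
    htam (bdpExistsAt₃_of_hsieh2014 W hH hres) h2 h3

end Assembly

end Summit.BirchSwinnertonDyer.Rank1Residual.X11b.Three

end
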